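import Mathlib

/-!
# Weighted mass bound (the Cauchy–Schwarz step of the derivative-free assembly [A′])

For a non-negative profile `f` on `(0, ∞)`, a growth rate `a` and an extra shift `γ₂ > 0`:
if `∫_{t>0} f(t)² e^{2(a+γ₂)t} dt ≤ Q` then `∫_{t>0} f(t) e^{a t} dt ≤ √(Q/(2γ₂))`.

This is `f e^{at} = (f e^{(a+γ₂)t}) · e^{-γ₂ t}` and Cauchy–Schwarz with `∫_{t>0} e^{-2γ₂ t} dt = 1/(2γ₂)`,
proved here through the pointwise AM–GM inequality with a free parameter and its optimisation, so that
no `MemLp`/measurability hypothesis on `f` is needed (a non-integrable left-hand side has integral `0`).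
In the assembly, `f = |k_R|`, `a = γε`, `a + γ₂ = γ'` and `Q = Q0′ = (1/2π)∫|R(-γ'+iω)|² dω` (Plancherel on the
shifted line); the lemma turns the `L²` datum `Q0′` into the `L¹` mass bound `√(Q0′/(2γ₂))`.
-/

namespace Summit.AnomalousDissipation.SoloBlind.WeightedMassBound

open MeasureTheory Set Real

/-- Pointwise AM–GM with a parameter: `x y ≤ (l/2) x² + y²/(2 l)` for `l > 0`. -/
theorem mul_le_param_sq (x y : ℝ) {l : ℝ} (hl : 0 < l) :
    x * y ≤ (l / 2) * x ^ 2 + y ^ 2 / (2 * l) := by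
  have key : x * y * (2 * l) ≤ l ^ 2 * x ^ 2 + y ^ 2 := by nlinarith [sq_nonneg (l * x - y)]
  have h2l : 0 < 2 * l := by positivity
  have : x * y ≤ (l ^ 2 * x ^ 2 + y ^ 2) / (2 * l) := by rwa [le_div_iff₀ h2l]
  calc x * y ≤ (l ^ 2 * x ^ 2 + y ^ 2) / (2 * l) := this
    _ = (l / 2) * x ^ 2 + y ^ 2 / (2 * l) := by field_simp

/-- `∫_{t>0} e^{-2γ₂ t} dt = 1/(2γ₂)`. -/
theorem integral_exp_neg_two_mul_Ioi {γ₂ : ℝ} (hγ : 0 < γ₂) :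
    ∫ t in Ioi (0:ℝ), Real.exp (-(2 * γ₂) * t) = 1 / (2 * γ₂) := by
  have h := integral_exp_mul_Ioi (show -(2 * γ₂) < 0 by linarith) 0
  simp only [mul_zero, Real.exp_zero] at h
  rw [h]; field_simp

/-- `t ↦ e^{-2γ₂ t}` is integrable on `(0, ∞)`. -/
theorem integrableOn_exp_neg_two_mul_Ioi {γ₂ : ℝ} (hγ : 0 < γ₂) :
    IntegrableOn (fun t : ℝ => Real.exp (-(2 * γ₂) * t)) (Ioi 0) :=
  exp_neg_integrableOn_Ioi 0 (by linarith)

/-- The optimisation step: if `M ≤ l Q/2 + 1/(4 l γ₂)` for every `l > 0` (with `Q ≥ 0`, `γ₂ > 0`)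
then `M ≤ √(Q/(2γ₂))`. -/
theorem le_sqrt_of_forall_param {M Q γ₂ : ℝ} (hγ : 0 < γ₂) (hQ : 0 ≤ Q)
    (h : ∀ l : ℝ, 0 < l → M ≤ l * Q / 2 + 1 / (4 * l * γ₂)) :
    M ≤ Real.sqrt (Q / (2 * γ₂)) := by
  set S := Real.sqrt (Q / (2 * γ₂)) with hS
  have hS0 : 0 ≤ S := Real.sqrt_nonneg _
  have hSsq : S ^ 2 = Q / (2 * γ₂) := by
    rw [hS, Real.sq_sqrt (by positivity)]
  have hQS : Q = 2 * γ₂ * S ^ 2 := by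
    rw [hSsq]; field_simp
  rcases lt_or_eq_of_le hS0 with hSpos | hSzero
  · -- take l = 1/(2 γ₂ S)
    have hl : 0 < 1 / (2 * γ₂ * S) := by positivity
    have := h _ hl
    have e1 : 1 / (2 * γ₂ * S) * Q / 2 = S / 2 := by
      rw [hQS]; field_simp
    have e2 : 1 / (4 * (1 / (2 * γ₂ * S)) * γ₂) = S / 2 := by
      field_simp; ring
    linarith [e1, e2]
  · -- S = 0, hence Q = 0, hence M ≤ 1/(4 l γ₂) for all l > 0, hence M ≤ 0
    have hQ0 : Q = 0 := by rw [hQS, ← hSzero]; ring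
    rw [← hSzero]
    by_contra hM
    push Not at hM
    have hl : 0 < 1 / (γ₂ * M) := by positivity
    have := h _ hl
    rw [hQ0] at this
    have e : 1 / (4 * (1 / (γ₂ * M)) * γ₂) = M / 4 := by field_simp
    rw [e] at this
    linarith

/-- **Weighted mass bound.**  For `f ≥ 0` on `(0,∞)`, `γ₂ > 0`:
`∫_{t>0} f² e^{2(a+γ₂)t} ≤ Q` (with that integrand integrable) implies `∫_{t>0} f e^{a t} ≤ √(Q/(2γ₂))`. -/
theorem weighted_mass_le {f : ℝ → ℝ} {a γ₂ Q : ℝ} (hγ : 0 < γ₂) (hf : ∀ t, 0 ≤ f t)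
    (hQi : IntegrableOn (fun t => f t ^ 2 * Real.exp (2 * (a + γ₂) * t)) (Ioi 0))
    (hQ : ∫ t in Ioi (0:ℝ), f t ^ 2 * Real.exp (2 * (a + γ₂) * t) ≤ Q) :
    ∫ t in Ioi (0:ℝ), f t * Real.exp (a * t) ≤ Real.sqrt (Q / (2 * γ₂)) := by
  have hQnn : 0 ≤ Q := le_trans (setIntegral_nonneg measurableSet_Ioi
      (fun t _ => mul_nonneg (sq_nonneg _) (Real.exp_pos _).le)) hQ
  refine le_sqrt_of_forall_param hγ hQnn fun l hl => ?_
  -- pointwise: f e^{at} ≤ (l/2) f² e^{2(a+γ₂)t} + e^{-2γ₂ t}/(2l)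
  have hpt : ∀ t, f t * Real.exp (a * t)
      ≤ (l / 2) * (f t ^ 2 * Real.exp (2 * (a + γ₂) * t)) + Real.exp (-(2 * γ₂) * t) / (2 * l) := by
    intro t
    have h1 := mul_le_param_sq (f t * Real.exp ((a + γ₂) * t)) (Real.exp (-γ₂ * t)) hl
    have e0 : f t * Real.exp ((a + γ₂) * t) * Real.exp (-γ₂ * t) = f t * Real.exp (a * t) := by
      rw [mul_assoc, ← Real.exp_add]; congr 2; ring
    have e1 : (f t * Real.exp ((a + γ₂) * t)) ^ 2 = f t ^ 2 * Real.exp (2 * (a + γ₂) * t) := by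
      rw [mul_pow, ← Real.exp_nat_mul]; congr 2; push_cast; ring
    have e2 : Real.exp (-γ₂ * t) ^ 2 = Real.exp (-(2 * γ₂) * t) := by
      rw [← Real.exp_nat_mul]; congr 1; push_cast; ring
    rw [e0, e1, e2] at h1
    linarith
  have hInt : Integrable (fun t => (l / 2) * (f t ^ 2 * Real.exp (2 * (a + γ₂) * t))
      + Real.exp (-(2 * γ₂) * t) / (2 * l)) (volume.restrict (Ioi 0)) := by
    refine (hQi.const_mul (l / 2)).add ?_
    have := (integrableOn_exp_neg_two_mul_Ioi hγ).div_const (2 * l)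
    exact this
  have hmono : ∫ t in Ioi (0:ℝ), f t * Real.exp (a * t)
      ≤ ∫ t in Ioi (0:ℝ), ((l / 2) * (f t ^ 2 * Real.exp (2 * (a + γ₂) * t))
        + Real.exp (-(2 * γ₂) * t) / (2 * l)) := by
    refine integral_mono_of_nonneg ?_ hInt ?_
    · exact Filter.Eventually.of_forall fun t => mul_nonneg (hf t) (Real.exp_pos _).le
    · exact Filter.Eventually.of_forall hpt
  have hsplit : ∫ t in Ioi (0:ℝ), ((l / 2) * (f t ^ 2 * Real.exp (2 * (a + γ₂) * t))
        + Real.exp (-(2 * γ₂) * t) / (2 * l))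
      = (l / 2) * (∫ t in Ioi (0:ℝ), f t ^ 2 * Real.exp (2 * (a + γ₂) * t))
        + (∫ t in Ioi (0:ℝ), Real.exp (-(2 * γ₂) * t)) / (2 * l) := by
    rw [integral_add (hQi.const_mul (l / 2)) ((integrableOn_exp_neg_two_mul_Ioi hγ).div_const (2 * l)),
      integral_const_mul, integral_div]
  rw [hsplit, integral_exp_neg_two_mul_Ioi hγ] at hmono
  have hl2 : 0 < l / 2 := by positivity
  have e3 : 1 / (2 * γ₂) / (2 * l) = 1 / (4 * l * γ₂) := by field_simp; ring
  rw [e3] at hmono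
  calc ∫ t in Ioi (0:ℝ), f t * Real.exp (a * t)
      ≤ (l / 2) * (∫ t in Ioi (0:ℝ), f t ^ 2 * Real.exp (2 * (a + γ₂) * t)) + 1 / (4 * l * γ₂) := hmono
    _ ≤ (l / 2) * Q + 1 / (4 * l * γ₂) := by gcongr
    _ = l * Q / 2 + 1 / (4 * l * γ₂) := by ring

end Summit.AnomalousDissipation.SoloBlind.WeightedMassBound
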